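import Summits.KontsevichZagierPeriods.KontsevichZagierPeriods.Theorems.MzvKernelInKZTwoPosetsStuffleBlocks
import Summits.KontsevichZagierPeriods.KontsevichZagierPeriods.Theorems.MzvKernelInKZTwoPosetsTransfer
import Literature.NumberTheory.Transcendental.KZGroundingRelations

/-!
# `MzvKernelInKZ` (stmt-KontsevichZagierPeriods-3914), line two-posets-interior-landen: the stuffle product inside the calculus

Registered stub `stub_stuffleProduct : CubicalChart → StuffleProductInKZ` of the lead's skeleton
(`Cruxes/MzvKernelInKZ/Lines/two-posets-interior-landen.lean`): for non-empty admissible `s, t`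
the harmonic (stuffle) product `[ζ(s)]·[ζ(t)] − ∑_{u ∈ s ∗ t} [ζ(u)]` of the canonical word
representations lies in `KZ.relations`. THE CHAIN (rules 2 and 1b of Kontsevich–Zagier only,
every intermediate an absolutely convergent positive rational representation on an open cube):
cubical charts on both factors (`CubicalChart`, rule 2) ⇒ the product representation on
`(0,1)^{|s|+|t|}` has integrand `G(S)·G(T)/∏z` (cubical block formula of `…StuffleBlocks.lean`),
which is `∑_{π ∈ S ∗ T} G(π)/∏z` by the stuffle identity of cubical generating functions
(three-term partial fractions recursing on the smallest summation indices, worker G's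
`StuffleComb`) — one n-ary integrand-additivity move (rule 1b); each pattern term is the cube
representation of its length vector `u` relabelled along the enumeration of the pattern (a
coordinate permutation, rule 2) and charted back to `[Δ, ω_u]` (rule 2); the length vectors of the
patterns enumerate `MZV.stuffle s t` with multiplicity (`qsh` naturality + `stuffle = qsh (+)`).

Sources: M. E. Hoffman, *The algebra of multiple harmonic series*, J. Algebra 194 (1997), §2
(A1)–(A3) and Thm 3.2; I. Soudères, Int. J. Number Theory 6 (2010), §1.3; M. Kontsevich,
D. Zagier, *Periods* (2001), §1.2.
-/

noncomputable section

namespace Summit.KontsevichZagierPeriods.MzvKernelInKZ.TwoPosets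

open Set MeasureTheory
open Literature.NumberTheory.Transcendental
open Summit.KontsevichZagierPeriods.MzvKernelInKZ.Negative

/-! ## Cube representations of an index -/

section CubeReps

/-- **Cube representations exist**: for admissible letters there is a representation on the open
cube with integrand exactly the cubical pull-back `cubicalFun ε q` (one instance of the tree's
monomial-chart transport, as in `stub_cubicalChart`). -/
theorem exists_cubeRep {N : ℕ} (ε : Fin N → Bool) (hε : Adm ε) (q : ℚ) :
    ∃ r : KZ.IntegralRep N, r.domain = cube N ∧ r.integrand = cubicalFun ε q := by
  have hS : ∀ i : Fin N, ∀ j ∈ Finset.univ.filter (fun j => j ≤ i), j ≤ i := fun i j hj =>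
    (Finset.mem_filter.mp hj).2
  have hS' : ∀ i : Fin N, i ∈ Finset.univ.filter (fun j => j ≤ i) := fun i =>
    Finset.mem_filter.mpr ⟨Finset.mem_univ _, le_rfl⟩
  have hT := Summit.KontsevichZagierPeriods.FurushoPentagon.HoffmanRelationInKZ.monomialChart_transport
    (fun i : Fin N => Finset.univ.filter (fun j => j ≤ i))
    hS hS' (isSemialgebraic_cube N)
    (cubicalMap N) (fun _ _ => rfl) (injOn_cubicalMap N) (cubicalFun ε q) (wordFun ε q)
    (fun y hy => cubicalFun_eq_mul_abs_jacobian ε q hy)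
  have hdom : (wordRep ε q hε).domain = cubicalMap N '' cube N := by
    rw [wordRep_domain, image_cubicalMap]
  obtain ⟨r, hrd, hri⟩ := hT.1 (wordRep ε q hε) hdom (fun _ _ => rfl)
  exact ⟨r, hrd, hri⟩

/-- The cube representation of an admissible index, with its congruence to the word
representation: `zIdx s 1 − [cube, cubicalFun] ∈ relations`. -/
theorem exists_cubeRep_zIdx (hC : CubicalChart) (s : List ℕ) (hs : MZV.IsAdmissible s) :
    ∃ r : KZ.IntegralRep s.sum, r.domain = cube s.sum ∧
      r.integrand = cubicalFun (bword s.sum s) 1 ∧ zIdx s 1 - KZ.of r ∈ KZ.relations := by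
  obtain ⟨r, hd, hi⟩ := exists_cubeRep (bword s.sum s) (adm_bword hs) 1
  refine ⟨r, hd, hi, ?_⟩
  rw [zIdx_of_adm hs]
  exact (hC s.sum (bword s.sum s) (adm_bword hs) 1).2 r hd (fun x _ => by rw [hi])

end CubeReps

/-! ## Patterns: the enumeration of a block pattern and its cube representation -/

section Patterns

variable {a b : ℕ}

/-- The embedded blocks of the two factors inside `Fin (a + b)`. -/
theorem blocks_data (s t : List ℕ) (hsa : s.sum = a) (htb : t.sum = b)
    (hs1 : ∀ i ∈ s, 1 ≤ i) (ht1 : ∀ i ∈ t, 1 ≤ i) :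
    let S := (cblocks a s).map (List.map (Fin.castAdd b))
    let T := (cblocks b t).map (List.map (Fin.natAdd a))
    (∀ B ∈ S, B ≠ []) ∧ (∀ B ∈ T, B ≠ []) ∧ (S.flatten ++ T.flatten).Nodup ∧
      (S.flatten ++ T.flatten).length = a + b ∧ S.map List.length = s ∧ T.map List.length = t := by
  intro S T
  have hSne : ∀ B ∈ S, B ≠ [] := by
    intro B hB
    obtain ⟨B', hB', rfl⟩ := List.mem_map.mp hB
    simpa using ne_nil_of_mem_cblocksFrom 0 s (by omega) hs1 B' hB'
  have hTne : ∀ B ∈ T, B ≠ [] := by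
    intro B hB
    obtain ⟨B', hB', rfl⟩ := List.mem_map.mp hB
    simpa using ne_nil_of_mem_cblocksFrom 0 t (by omega) ht1 B' hB'
  have hSf : S.flatten = (cblocks a s).flatten.map (Fin.castAdd b) := flatten_map_map _ _
  have hTf : T.flatten = (cblocks b t).flatten.map (Fin.natAdd a) := flatten_map_map _ _
  refine ⟨hSne, hTne, ?_, ?_, ?_, ?_⟩
  · rw [hSf, hTf, List.nodup_append]
    refine ⟨(nodup_flatten_cblocksFrom 0 s (by omega)).map (Fin.castAdd_injective _ _),
      (nodup_flatten_cblocksFrom 0 t (by omega)).map (Fin.natAdd_injective _ _), ?_⟩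
    intro x hx y hy hxy
    obtain ⟨i, -, rfl⟩ := List.mem_map.mp hx
    obtain ⟨j, -, rfl⟩ := List.mem_map.mp hy
    have := congrArg Fin.val hxy
    simp at this
    omega
  · rw [List.length_append, hSf, hTf, List.length_map, List.length_map,
      List.length_flatten, List.length_flatten, map_length_cblocks (by omega : s.sum ≤ a),
      map_length_cblocks (by omega : t.sum ≤ b), hsa, htb]
  · rw [List.map_map]
    have : (List.length ∘ List.map (Fin.castAdd b) : List (Fin a) → ℕ) = List.length := by
      funext B; simp
    rw [this, map_length_cblocks (by omega : s.sum ≤ a)]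
  · rw [List.map_map]
    have : (List.length ∘ List.map (Fin.natAdd a) : List (Fin b) → ℕ) = List.length := by
      funext B; simp
    rw [this, map_length_cblocks (by omega : t.sum ≤ b)]

end Patterns

/-! ## The representation of a block pattern -/

section PatternRep

/-- Reconstruction from offset `0` (the form used below). -/
theorem map_cblocks_eq {α : Type*} {n : ℕ} (π : List (List α)) (g : Fin n → α)
    (hn : (π.map List.length).sum = n)
    (hg : ∀ (i : ℕ) (hi : i < π.flatten.length), g ⟨i, by
        rw [List.length_flatten] at hi; omega⟩ = π.flatten[i]) :
    (cblocks n (π.map List.length)).map (List.map g) = π := by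
  refine map_cblocksFrom_eq π 0 g (by omega) fun i hi => ?_
  have h := hg i hi
  have e : (⟨0 + i, by rw [List.length_flatten] at hi; omega⟩ : Fin n) =
      ⟨i, by rw [List.length_flatten] at hi; omega⟩ := Fin.ext (Nat.zero_add i)
  rw [e, h]

/-- A list sum as a sum over the positions. -/
theorem sum_fin_getElem {α M : Type*} [AddCommMonoid M] (f : α → M) (L : List α) :
    ∑ i : Fin L.length, f L[(i : ℕ)] = (L.map f).sum := by
  rw [← List.sum_ofFn]
  change (List.ofFn (f ∘ fun i : Fin L.length => L[(i : ℕ)])).sum = _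
  rw [← List.map_ofFn, List.ofFn_getElem]

/-- The cube is invariant under relabelling of the coordinates by a bijection. -/
theorem comp_mem_cube_iff {n m : ℕ} (σ : Fin m ≃ Fin n) (w : Fin n → ℝ) :
    (fun j => w (σ j)) ∈ cube m ↔ w ∈ cube n := by
  simp only [cube, Set.mem_setOf_eq]
  constructor
  · intro h i
    simpa using h (σ.symm i)
  · intro h j
    exact h (σ j)

/-- **The representation of a block pattern.** For a block pattern `π` on `Fin n` that uses every
coordinate exactly once and whose length vector `u` is an admissible index, there is a
representation on the open cube `(0,1)ⁿ` with integrand `G(π)/∏ zᵢ = gfun z 1 π / ∏ zᵢ`, congruent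
modulo relations to the word representation `zIdx u 1`: it is the cube representation of `u`
(cubical chart, rule 2) relabelled along the enumeration `j ↦ π.flatten[j]` (a coordinate
permutation, rule 2), by the cubical block formula and the reconstruction of `π` from the
consecutive blocks of `u`. -/
theorem exists_patternRep (hC : CubicalChart) {n : ℕ} (π : List (List (Fin n)))
    (hu : MZV.IsAdmissible (π.map List.length)) (hnd : π.flatten.Nodup)
    (hlen : π.flatten.length = n) :
    ∃ R : KZ.IntegralRep n, R.domain = cube n ∧
      (∀ z ∈ cube n, R.integrand z = gfun z 1 π / ∏ i, z i) ∧
      zIdx (π.map List.length) 1 - KZ.of R ∈ KZ.relations := by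
  set u := π.map List.length with hu_def
  have hsum : u.sum = n := by rw [hu_def, ← List.length_flatten, hlen]
  have hu1 : ∀ i ∈ u, 1 ≤ i := hu.1
  obtain ⟨C, hCd, hCi, hCr⟩ := exists_cubeRep_zIdx hC u hu
  -- the enumeration of the pattern
  have hlen' : u.sum = π.flatten.length := by rw [hsum, hlen]
  let g : Fin u.sum → Fin n := fun j => π.flatten.get (Fin.cast hlen' j)
  have hginj : Function.Injective g :=
    (List.nodup_iff_injective_get.mp hnd).comp (Fin.cast_injective hlen')
  have hgbij : Function.Bijective g := by
    rw [Fintype.bijective_iff_injective_and_card]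
    exact ⟨hginj, by simp [hsum]⟩
  let σ : Fin u.sum ≃ Fin n := Equiv.ofBijective g hgbij
  have hσ : ∀ j, σ j = g j := fun _ => rfl
  -- reconstruction of `π` from the consecutive blocks of `u`
  have hrec : (cblocks u.sum u).map (List.map σ) = π := by
    refine map_cblocks_eq π σ rfl fun i hi => ?_
    rw [hσ]
    simp [g, List.get_eq_getElem]
  refine ⟨C.reindex σ, ?_, ?_, ?_⟩
  · rw [KZ.IntegralRep.reindex_domain, hCd]
    ext w
    exact comp_mem_cube_iff σ w
  · intro z hz
    have hz' : (fun j => z (σ j)) ∈ cube u.sum := (comp_mem_cube_iff σ z).mpr hz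
    have hz0 : ∀ j, (fun j => z (σ j)) j ≠ 0 := fun j => (hz' j).1.ne'
    rw [KZ.IntegralRep.reindex_integrand, hCi]
    change cubicalFun (bword u.sum u) 1 (fun j => z (σ j)) = _
    rw [cubicalFun_bword_eq_gfun_div u hu1 _ hz0]
    have e1 : gfun (fun j => z (σ j)) 1 (cblocks u.sum u) = gfun z 1 π := by
      rw [← hrec, gfun_map z σ 1 (cblocks u.sum u)]; rfl
    rw [e1]
    congr 1
    exact Equiv.prod_comp σ z
  · have h2 := KZ.of_sub_of_reindex_mem_relations C σ
    have : zIdx u 1 - KZ.of (C.reindex σ) = (zIdx u 1 - KZ.of C) + (KZ.of C - KZ.of (C.reindex σ)) := by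
      abel
    rw [this]
    exact add_mem hCr h2

end PatternRep

/-! ## The stuffle product inside the calculus -/

section Assembly

/-- **THE STUFFLE PRODUCT IS A MOVE CHAIN** (core of the registered stub `stub_stuffleProduct`,
with the combinatorial interface `StuffleComb` as an explicit hypothesis). For non-empty
admissible `s`, `t`: `[ζ(s)]·[ζ(t)] − ∑_{u ∈ s ∗ t} [ζ(u)] ∈ KZ.relations`. Chain: cubical charts
on both factors (rule 2); the product representation on `(0,1)^{|s|+|t|}` has integrand
`G(S)G(T)/∏z = ∑_{π ∈ S ∗ T} G(π)/∏z` (the stuffle identity of cubical generating functions, all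
terms positive: rule 1b, n-ary); each pattern term is the cube representation of its length vector
relabelled by a coordinate permutation (rule 2) and charted back to the word representation
(rule 2); the length vectors enumerate `MZV.stuffle s t` with multiplicity. -/
theorem stuffleProduct_of_stuffleComb (hC : CubicalChart) (hComb : StuffleComb) (s t : List ℕ)
    (hs : MZV.IsAdmissible s) (ht : MZV.IsAdmissible t) :
    zIdx s 1 * zIdx t 1 - ((MZV.stuffle s t).map fun u => zIdx u 1).sum ∈ KZ.relations := by
  obtain ⟨hstuffle, hmapq, hflat, hne, hgg⟩ := hComb
  have hs1 : ∀ i ∈ s, 1 ≤ i := hs.1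
  have ht1 : ∀ i ∈ t, 1 ≤ i := ht.1
  -- cube representations of the two factors and their product
  obtain ⟨Cs, hCsd, hCsi, hCsr⟩ := exists_cubeRep_zIdx hC s hs
  obtain ⟨Ct, hCtd, hCti, hCtr⟩ := exists_cubeRep_zIdx hC t ht
  set P : KZ.IntegralRep (s.sum + t.sum) := Cs.prod Ct with hP
  have hPd : P.domain = cube (s.sum + t.sum) := by
    ext z
    rw [hP, KZ.IntegralRep.prod_domain, KZ.IntegralRep.mem_prodDomain, hCsd, hCtd]
    simp only [cube, Set.mem_setOf_eq]
    exact (Fin.forall_fin_add (fun k => 0 < z k ∧ z k < 1)).symm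
  have hPi : P.integrand = KZ.IntegralRep.prodFun Cs Ct :=
    (KZ.IntegralRep.leftResolves Cs).prod_integrand Ct
  -- the block patterns
  obtain ⟨hSne, hTne, hnodup, hlen, hSlen, hTlen⟩ := blocks_data s t rfl rfl hs1 ht1
  set S := (cblocks s.sum s).map (List.map (Fin.castAdd t.sum)) with hS_def
  set T := (cblocks t.sum t).map (List.map (Fin.natAdd s.sum)) with hT_def
  set L := qsh (· ++ ·) S T with hL
  have hLidx : L.map (List.map List.length) = MZV.stuffle s t := by
    rw [hL, hmapq (· ++ ·) (· + ·) List.length (fun A B => List.length_append) S T, hSlen, hTlen,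
      hstuffle]
  have hLi : ∀ i : Fin L.length, (L[(i : ℕ)]).map List.length ∈ MZV.stuffle s t := fun i => by
    rw [← hLidx]; exact List.mem_map.mpr ⟨L[(i : ℕ)], List.getElem_mem _, rfl⟩
  have hLadm : ∀ i : Fin L.length, MZV.IsAdmissible ((L[(i : ℕ)]).map List.length) := fun i =>
    MZV.isAdmissible_of_mem_stuffle hs ht (hLi i)
  have hLnd : ∀ i : Fin L.length, (L[(i : ℕ)]).flatten.Nodup := fun i =>
    (hflat S T _ (List.getElem_mem _)).nodup_iff.mpr hnodup
  have hLlen : ∀ i : Fin L.length, (L[(i : ℕ)]).flatten.length = s.sum + t.sum := fun i => by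
    rw [(hflat S T _ (List.getElem_mem _)).length_eq, hlen]
  -- the pattern representations
  choose R hRd hRi hRr using fun i : Fin L.length =>
    exists_patternRep hC (L[(i : ℕ)]) (hLadm i) (hLnd i) (hLlen i)
  -- (rule 1b, n-ary) the product integrand is the sum of the pattern integrands
  have hadd : KZ.of P - ∑ i : Fin L.length, KZ.of (R i) ∈ KZ.relations := by
    refine KZ.of_sub_sum_integrand_mem_relations Finset.univ R P (fun i _ => by rw [hRd, hPd]) ?_
    intro z hz
    rw [hPd] at hz
    have hz0 : ∀ k, z k ≠ 0 := fun k => (hz k).1.ne'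
    change P.integrand z = ∑ i : Fin L.length, (R i).integrand z
    rw [hPi, KZ.IntegralRep.prodFun_apply, hCsi, hCti,
      cubicalFun_bword_eq_gfun_div s hs1 _ (fun i => hz0 _),
      cubicalFun_bword_eq_gfun_div t ht1 _ (fun j => hz0 _)]
    rw [Finset.sum_congr rfl fun i _ => hRi i z hz, ← Finset.sum_div,
      sum_fin_getElem (fun π => gfun z 1 π) L, hL, ← hgg z hz S T hSne hTne]
    rw [hS_def, hT_def, gfun_map, gfun_map, Fin.prod_univ_add]
    have h1 : (∏ i : Fin s.sum, z (Fin.castAdd t.sum i)) ≠ 0 :=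
      Finset.prod_ne_zero_iff.mpr fun i _ => hz0 _
    have h2 : (∏ j : Fin t.sum, z (Fin.natAdd s.sum j)) ≠ 0 :=
      Finset.prod_ne_zero_iff.mpr fun j _ => hz0 _
    field_simp
    rfl
  -- each pattern representation is the word representation of its length vector
  have hterms : ∑ i : Fin L.length, KZ.of (R i) -
      ((MZV.stuffle s t).map fun u => zIdx u 1).sum ∈ KZ.relations := by
    rw [← hLidx, List.map_map, ← sum_fin_getElem, ← Finset.sum_sub_distrib]
    refine sum_mem fun i _ => ?_
    have := KZ.relations.neg_mem (hRr i)
    rwa [neg_sub] at this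
  -- the factors
  have hfac : zIdx s 1 * zIdx t 1 - KZ.of P ∈ KZ.relations := by
    have e : zIdx s 1 * zIdx t 1 - KZ.of P =
        (zIdx s 1 - KZ.of Cs) * zIdx t 1 + KZ.of Cs * (zIdx t 1 - KZ.of Ct) := by
      rw [hP, ← KZ.of_mul_of, sub_mul, mul_sub]; abel
    rw [e]
    exact add_mem (KZ.mul_mem_relations_right_holds _ _ hCsr) (KZ.mul_mem_relations_left_holds _ _ hCtr)
  have e : zIdx s 1 * zIdx t 1 - ((MZV.stuffle s t).map fun u => zIdx u 1).sum =
      (zIdx s 1 * zIdx t 1 - KZ.of P) + (KZ.of P - ∑ i : Fin L.length, KZ.of (R i)) +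
        (∑ i : Fin L.length, KZ.of (R i) - ((MZV.stuffle s t).map fun u => zIdx u 1).sum) := by abel
  rw [e]
  exact add_mem (add_mem hfac hadd) hterms

/-- **Registered stub `stub_stuffleProduct`** of the line two-posets-interior-landen: the stuffle
product of the canonical word representations of non-empty admissible indices is a move chain
(cubical charts + the positive three-term partial fractions of the cubical generating functions +
coordinate permutations), fed by the landed `stub_stuffleComb`. -/
theorem stub_stuffleProduct : CubicalChart → StuffleProductInKZ :=
  fun hC s t hs ht _ _ => stuffleProduct_of_stuffleComb hC stub_stuffleComb s t hs ht

end Assembly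

end Summit.KontsevichZagierPeriods.MzvKernelInKZ.TwoPosets
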